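import Mathlib
import Summits.Schanuel.Schanuel.Theses.RigidCore
import Summits.Schanuel.Schanuel.Theorems.AclSubsetLogFreeCore.Negative.ExpAclDefinability
import Literature.ModelTheory.ExponentialFields.DefinabilityParams

/-!
# Crux `MinimalCounterexampleInAcl` (stmt-Schanuel-0969) — definable isolation is FREE (Stub I proved)

Support for the line `span-growth-dichotomy` (stub `stub_isolationFree`) and negative knowledge for the
crux (S*) `RigidCore.MinimalCounterexampleInAcl`, landed by the crux disprover (`--supports`).  The set
of *locus mates* of `x` is written out verbatim (`{x' | LinearIndependent ℚ x' ∧ ∀ p, p(x,eˣ)=0 →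
p(x',e^{x'})=0}`, the skeleton's `locusMates x` by `rfl`).  All PROVED:

* `definableFun_ratCast'`, `definableFun_expPoly`, `definable_expPoly_zero` — exponential polynomials
  over `ℚ` are `∅`-definable functions on `(ℂ, +, ·, −, 0, 1, exp)`;
* `definable_locusCondition` — "satisfies every ℚ-relation of `(x, eˣ)`" is `∅`-definable for each
  fixed `x` (Hilbert basis: the relation ideal `relIdeal x` is finitely generated; `x` is eliminated,
  it is not a parameter);
* `definable_linearIndependent` — **ℚ-linear independence is ONE `∅`-formula** (`ℤ` is `∅`-definable
  in `ℂ_exp`, KMO 2012 §2.2, `intSet`; clearing denominators `intDependent_of_ratDependent`);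
* `definable_locusMates`, `definable₁_image_eval`, and **`isolationFree`**: if the locus mates of a
  ℚ-linearly independent `x` are finitely many then every `x i` lies in a finite `∅`-definable set —
  the skeleton's `stub_isolationFree` WITHOUT its first-failure hypothesis;
* `minimalCounterexampleInAcl_of_firstFailureSparsity` — hence (S*) follows from "first failures have
  finitely many locus mates": its open content is pure finiteness (Stubs D + M), no model theory.

## References

* [KirbyMacintyreOnshuus2012] J. Kirby, A. Macintyre, A. Onshuus, *The algebraic numbers definable in
  various exponential fields*, J. Inst. Math. Jussieu 11 (2012), arXiv:1101.4224, §2.2.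
* D. Marker, *Model Theory: An Introduction*, GTM 217, §1.3 (definable sets, projections).
-/

noncomputable section

set_option linter.dupNamespace false

open Complex Set
open FirstOrder FirstOrder.Language
open Literature.NumberTheory.Transcendental
open Literature.ModelTheory.ExponentialFields
open Summit.Schanuel.Schanuel.Theorems.AclSubsetLogFreeCore.Negative

namespace Summit.Schanuel.Schanuel.Theorems.MinimalCounterexampleInAcl.Negative

section IsolationFree

variable {α : Type*}

/-- Rational constants are `∅`-definable functions (`q` is the unique `y` with `den(q)·y = num(q)`). [folklore] -/
theorem definableFun_ratCast' (q : ℚ) :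
    (∅ : Set ℂ).DefinableFun Language.expRing (fun _ : α → ℂ => (q : ℂ)) := by
  have h : (∅ : Set ℂ).Definable Language.expRing
      {w : Option α → ℂ | (q.den : ℂ) * w none = (q.num : ℂ)} :=
    definable_setOf_eq_params
      (definableFun_mul' (definableFun_natCast' q.den) (definableFun_proj_params none))
      (definableFun_intCast' q.num)
  unfold Set.DefinableFun
  convert h using 1
  ext w
  simp only [Function.tupleGraph, mem_setOf_eq]
  have hd : (q.den : ℂ) ≠ 0 := Nat.cast_ne_zero.2 q.den_nz
  rw [Rat.cast_def]
  constructor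
  · intro hw
    rw [← hw]
    field_simp
  · intro hw
    rw [← hw]
    field_simp

/-- **Exponential polynomials over `ℚ` are `∅`-definable functions**:
`v ↦ p(v, e^v)` for `p ∈ ℚ[X₁..Xₙ, Y₁..Yₙ]`. [folklore] -/
theorem definableFun_expPoly {n : ℕ} (p : MvPolynomial (Fin n ⊕ Fin n) ℚ) :
    (∅ : Set ℂ).DefinableFun Language.expRing
      (fun v : Fin n → ℂ => MvPolynomial.aeval (Sum.elim v (cexp ∘ v)) p) := by
  induction p using MvPolynomial.induction_on with
  | C a => simpa using definableFun_ratCast' (α := Fin n) a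
  | add p q hp hq => simpa using definableFun_add' hp hq
  | mul_X p i hp =>
    rcases i with i | i
    · simpa using definableFun_mul' hp (definableFun_proj_params i)
    · simpa using definableFun_mul' hp (definableFun_cexp (definableFun_proj_params i))

/-- The zero set of an exponential polynomial over `ℚ` is `∅`-definable. [folklore] -/
theorem definable_expPoly_zero {n : ℕ} (p : MvPolynomial (Fin n ⊕ Fin n) ℚ) :
    (∅ : Set ℂ).Definable Language.expRing
      {v : Fin n → ℂ | MvPolynomial.aeval (Sum.elim v (cexp ∘ v)) p = 0} :=
  definable_setOf_eq_params (definableFun_expPoly p) definableFun_zero'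

/-- The relation ideal of `(x, eˣ)` over `ℚ`. [folklore] -/
def relIdeal {n : ℕ} (x : Fin n → ℂ) : Ideal (MvPolynomial (Fin n ⊕ Fin n) ℚ) :=
  RingHom.ker (MvPolynomial.aeval (R := ℚ) (Sum.elim x (cexp ∘ x))).toRingHom

/-- Membership in the relation ideal. [folklore] -/
theorem mem_relIdeal_iff {n : ℕ} (x : Fin n → ℂ) (p : MvPolynomial (Fin n ⊕ Fin n) ℚ) :
    p ∈ relIdeal x ↔ MvPolynomial.aeval (Sum.elim x (cexp ∘ x)) p = 0 :=
  RingHom.mem_ker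

/-- Hilbert basis: the relation ideal is finitely generated, so "satisfies every relation of
`(x, eˣ)`" is a FINITE conjunction. [folklore] -/
theorem exists_finset_relIdeal {n : ℕ} (x : Fin n → ℂ) :
    ∃ G : Finset (MvPolynomial (Fin n ⊕ Fin n) ℚ), Ideal.span (G : Set _) = relIdeal x := by
  have hfg : (relIdeal x).FG := IsNoetherian.noetherian _
  exact hfg

/-- **The locus condition is `∅`-definable** (for each fixed `x`; `x` is NOT a parameter — it is
eliminated through a finite generating set of its relation ideal). [folklore] -/
theorem definable_locusCondition {n : ℕ} (x : Fin n → ℂ) :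
    (∅ : Set ℂ).Definable Language.expRing
      {x' : Fin n → ℂ | ∀ p : MvPolynomial (Fin n ⊕ Fin n) ℚ,
        MvPolynomial.aeval (Sum.elim x (cexp ∘ x)) p = 0 →
        MvPolynomial.aeval (Sum.elim x' (cexp ∘ x')) p = 0} := by
  classical
  obtain ⟨G, hG⟩ := exists_finset_relIdeal x
  have hdef : (∅ : Set ℂ).Definable Language.expRing
      (⋂ g ∈ G, {v : Fin n → ℂ | MvPolynomial.aeval (Sum.elim v (cexp ∘ v)) g = 0}) :=
    Set.definable_biInter_finset (fun g => definable_expPoly_zero g) G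
  convert hdef using 1
  ext x'
  simp only [mem_setOf_eq, mem_iInter]
  constructor
  · intro h g hg
    refine h g ?_
    rw [← mem_relIdeal_iff, ← hG]
    exact Ideal.subset_span hg
  · intro h p hp
    rw [← mem_relIdeal_iff, ← hG] at hp
    have hle : Ideal.span (G : Set _) ≤ relIdeal x' := by
      rw [Ideal.span_le]
      intro g hg
      exact (mem_relIdeal_iff x' g).2 (h g hg)
    exact (mem_relIdeal_iff x' p).1 (hle hp)

/-- Finite sums of definable functions are definable. [folklore] -/
theorem definableFun_finset_sum {ι : Type*} (s : Finset ι) {f : ι → (α → ℂ) → ℂ}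
    (hf : ∀ i ∈ s, (∅ : Set ℂ).DefinableFun Language.expRing (f i)) :
    (∅ : Set ℂ).DefinableFun Language.expRing (fun v => ∑ i ∈ s, f i v) := by
  classical
  induction s using Finset.induction_on with
  | empty => simpa using (definableFun_zero' (A := (∅ : Set ℂ)) (α := α))
  | insert a s ha ih =>
    have h := definableFun_add' (hf a (Finset.mem_insert_self a s))
      (ih fun i hi => hf i (Finset.mem_insert_of_mem hi))
    simpa [Finset.sum_insert ha] using h

/-- **ℤ-linear dependence is `∅`-definable** (`ℤ` is `∅`-definable in `ℂ_exp`, KMO §2.2):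
the set of `v ∈ ℂⁿ` admitting integers `m`, not all zero, with `Σ mⱼ vⱼ = 0`. [folklore] -/
theorem definable_intDependent (n : ℕ) :
    (∅ : Set ℂ).Definable Language.expRing
      {v : Fin n → ℂ | ∃ m : Fin n → ℂ, (∀ j, m j ∈ intSet) ∧ (∃ j, m j ≠ 0) ∧
        ∑ j, m j * v j = 0} := by
  classical
  -- the inner condition on `(v, m) : Fin n ⊕ Fin n → ℂ`
  have h1 : (∅ : Set ℂ).Definable Language.expRing
      {u : Fin n ⊕ Fin n → ℂ | ∀ j, u (Sum.inr j) ∈ intSet} := by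
    have := Set.definable_iInter_of_finite (A := (∅ : Set ℂ)) (L := Language.expRing)
      (f := fun j : Fin n => {u : Fin n ⊕ Fin n → ℂ | u (Sum.inr j) ∈ intSet})
      (fun j => definable_mem_intSet (definableFun_proj_params (Sum.inr j)))
    convert this using 1
    ext u; simp
  have h2 : (∅ : Set ℂ).Definable Language.expRing
      {u : Fin n ⊕ Fin n → ℂ | ∃ j, u (Sum.inr j) ≠ 0} := by
    have := Set.definable_iUnion_of_finite (A := (∅ : Set ℂ)) (L := Language.expRing)
      (f := fun j : Fin n => {u : Fin n ⊕ Fin n → ℂ | ¬ u (Sum.inr j) = 0})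
      (fun j => definable_setOf_not_params
        (definable_setOf_eq_params (definableFun_proj_params (Sum.inr j)) definableFun_zero'))
    convert this using 1
    ext u; simp
  have h3 : (∅ : Set ℂ).Definable Language.expRing
      {u : Fin n ⊕ Fin n → ℂ | ∑ j, u (Sum.inr j) * u (Sum.inl j) = 0} :=
    definable_setOf_eq_params
      (definableFun_finset_sum Finset.univ fun j _ =>
        definableFun_mul' (definableFun_proj_params (Sum.inr j)) (definableFun_proj_params (Sum.inl j)))
      definableFun_zero'
  have h := ((h1.inter h2).inter h3).exists_of_finite (β := Fin n) (α := Fin n)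
  convert h using 1
  ext v
  simp only [mem_setOf_eq, mem_inter_iff, Sum.elim_inr, Sum.elim_inl]
  constructor
  · rintro ⟨m, hm, hne, hsum⟩
    exact ⟨m, ⟨hm, hne⟩, hsum⟩
  · rintro ⟨m, ⟨hm, hne⟩, hsum⟩
    exact ⟨m, hm, hne, hsum⟩

/-- Clearing denominators: a nonzero rational relation gives a nonzero integer relation. [folklore] -/
theorem intDependent_of_ratDependent {n : ℕ} {v : Fin n → ℂ} {q : Fin n → ℚ}
    (hq : q ≠ 0) (hsum : ∑ j, (q j : ℂ) * v j = 0) :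
    ∃ m : Fin n → ℂ, (∀ j, m j ∈ intSet) ∧ (∃ j, m j ≠ 0) ∧ ∑ j, m j * v j = 0 := by
  classical
  -- common denominator
  set D : ℕ := ∏ j, (q j).den with hD
  have hD0 : (D : ℚ) ≠ 0 := by
    rw [hD]; exact_mod_cast Finset.prod_ne_zero_iff.2 fun j _ => (q j).den_nz
  have hint : ∀ j, ∃ z : ℤ, ((D : ℚ) * q j) = z := by
    intro j
    have hsplit : (D : ℚ) = (∏ i ∈ Finset.univ.erase j, ((q i).den : ℚ)) * (q j).den := by
      rw [hD, Nat.cast_prod, ← Finset.prod_erase_mul _ _ (Finset.mem_univ j)]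
    refine ⟨(∏ i ∈ Finset.univ.erase j, ((q i).den : ℤ)) * (q j).num, ?_⟩
    rw [hsplit, mul_assoc, Rat.den_mul_eq_num]
    push_cast
    ring
  choose z hz using hint
  refine ⟨fun j => (z j : ℂ), fun j => mem_intSet_iff.2 ⟨z j, rfl⟩, ?_, ?_⟩
  · obtain ⟨j, hj⟩ : ∃ j, q j ≠ 0 := by
      by_contra hall
      push Not at hall
      exact hq (funext hall)
    refine ⟨j, ?_⟩
    have : (z j : ℚ) ≠ 0 := by rw [← hz]; exact mul_ne_zero hD0 hj
    show (z j : ℂ) ≠ 0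
    exact_mod_cast this
  · have : ∑ j, (z j : ℂ) * v j = (D : ℂ) * ∑ j, (q j : ℂ) * v j := by
      rw [Finset.mul_sum]
      refine Finset.sum_congr rfl fun j _ => ?_
      have hzj : ((z j : ℚ) : ℂ) = ((D : ℚ) * q j : ℚ) := by rw [hz]
      rw [← mul_assoc]
      congr 1
      have : ((z j : ℚ) : ℂ) = (z j : ℂ) := by norm_cast
      rw [← this, hzj]
      push_cast
      ring
    rw [this, hsum, mul_zero]

/-- **Linear independence over `ℚ` is `∅`-definable in `ℂ_exp`.** [folklore] -/
theorem definable_linearIndependent (n : ℕ) :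
    (∅ : Set ℂ).Definable Language.expRing {v : Fin n → ℂ | LinearIndependent ℚ v} := by
  have h := (definable_intDependent n).compl
  convert h using 1
  ext v
  simp only [mem_setOf_eq, mem_compl_iff]
  rw [Fintype.linearIndependent_iff]
  constructor
  · rintro hli ⟨m, hm, ⟨j₀, hj₀⟩, hsum⟩
    choose z hz using fun j => mem_intSet_iff.1 (hm j)
    have h0 := hli (fun j => (z j : ℚ)) (by
      rw [← hsum]
      refine Finset.sum_congr rfl fun j _ => ?_
      rw [hz j, Rat.smul_def]
      push_cast
      rfl)
    have := h0 j₀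
    apply hj₀
    rw [hz j₀]
    exact_mod_cast this
  · intro hnot g hg
    by_contra hne
    push Not at hne
    obtain ⟨i, hi⟩ := hne
    refine hnot (intDependent_of_ratDependent (q := g) ?_ ?_)
    · intro h0; exact hi (by rw [h0]; rfl)
    · rw [← hg]
      refine Finset.sum_congr rfl fun j _ => ?_
      rw [Rat.smul_def]

/-- **`locusMates x` is `∅`-definable** as an `n`-ary relation. [folklore] -/
theorem definable_locusMates {n : ℕ} (x : Fin n → ℂ) :
    (∅ : Set ℂ).Definable Language.expRing
      {x' : Fin n → ℂ | LinearIndependent ℚ x' ∧ ∀ p : MvPolynomial (Fin n ⊕ Fin n) ℚ,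
        MvPolynomial.aeval (Sum.elim x (cexp ∘ x)) p = 0 → MvPolynomial.aeval (Sum.elim x' (cexp ∘ x')) p = 0} :=
  (definable_linearIndependent n).inter (definable_locusCondition x)

/-- Coordinate projections of an `∅`-definable set of tuples are `∅`-definable subsets of `ℂ`. [folklore] -/
theorem definable₁_image_eval {n : ℕ} {S : Set (Fin n → ℂ)}
    (hS : (∅ : Set ℂ).Definable Language.expRing S) (i : Fin n) :
    Set.Definable₁ (∅ : Set ℂ) Language.expRing ((fun x' : Fin n → ℂ => x' i) '' S) := by
  have h := hS.image_comp (fun _ : Fin 1 => i)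
  unfold Set.Definable₁
  convert h using 1
  ext v
  simp only [mem_setOf_eq, mem_image]
  constructor
  · rintro ⟨x', hx', hv⟩
    refine ⟨x', hx', ?_⟩
    funext j
    rw [Subsingleton.elim j 0]
    simpa using hv
  · rintro ⟨x', hx', rfl⟩
    exact ⟨x', hx', rfl⟩

/-- **STUB I PROVED — definable isolation is free**: if the locus mates of a ℚ-linearly independent
`x` are finitely many, every coordinate `x i` lies in a FINITE `∅`-definable subset of `ℂ_exp`
(namely the `i`-th coordinates of the mates).  No first-failure hypothesis and no parameter is
needed: `ℤ` is `∅`-definable (KMO) so "ℚ-linearly independent" is one `∅`-formula, and the locus is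
cut out by finitely many relations with rational coefficients (Hilbert basis). [folklore] -/
theorem isolationFree {n : ℕ} {x : Fin n → ℂ} (hx : LinearIndependent ℚ x)
    (hfin : Set.Finite {x' : Fin n → ℂ | LinearIndependent ℚ x' ∧ ∀ p : MvPolynomial (Fin n ⊕ Fin n) ℚ,
        MvPolynomial.aeval (Sum.elim x (cexp ∘ x)) p = 0 → MvPolynomial.aeval (Sum.elim x' (cexp ∘ x')) p = 0}) (i : Fin n) :
    ∃ s : Set ℂ, s.Finite ∧ Set.Definable₁ (∅ : Set ℂ) Language.expRing s ∧ x i ∈ s :=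
  ⟨(fun x' : Fin n → ℂ => x' i) '' {x' : Fin n → ℂ | LinearIndependent ℚ x' ∧ ∀ p : MvPolynomial (Fin n ⊕ Fin n) ℚ,
        MvPolynomial.aeval (Sum.elim x (cexp ∘ x)) p = 0 → MvPolynomial.aeval (Sum.elim x' (cexp ∘ x')) p = 0}, hfin.image _,
    definable₁_image_eval (definable_locusMates x) i, ⟨x, ⟨hx, fun _ hp => hp⟩, rfl⟩⟩

/-- Hence **the crux follows from FIRST-FAILURE SPARSITY** ("a first failure has only finitely many
locus mates"), a statement with no definability in it: the open content of (S*) is pure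
unlikely-intersection finiteness (Stubs D + M of the line `span-growth-dichotomy`), not model theory.
[folklore] -/
theorem minimalCounterexampleInAcl_of_firstFailureSparsity
    (h : ∀ (n : ℕ) (x : Fin n → ℂ), LinearIndependent ℚ x →
      Algebra.trdeg ℚ ↥(IntermediateField.adjoin ℚ (range x ∪ range (cexp ∘ x))) < (n : Cardinal) →
      (∀ r < n, SchanuelRank r) → Set.Finite {x' : Fin n → ℂ | LinearIndependent ℚ x' ∧ ∀ p : MvPolynomial (Fin n ⊕ Fin n) ℚ,
        MvPolynomial.aeval (Sum.elim x (cexp ∘ x)) p = 0 → MvPolynomial.aeval (Sum.elim x' (cexp ∘ x')) p = 0}) :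
    Summit.Schanuel.Schanuel.Theses.RigidCore.MinimalCounterexampleInAcl :=
  fun n x hli htr hrank i => isolationFree hli (h n x hli htr hrank) i

end IsolationFree

end Summit.Schanuel.Schanuel.Theorems.MinimalCounterexampleInAcl.Negative

end
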